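import Summits.Ventures.CertifiedQuantumChemistry.Rows.CIUpperBound
import HarnessLib

/-!
# Ventures/CertifiedQuantumChemistry — Rows/CIRayleighQuotient.lean: the exact-`ℚ` CI record EVALUATES to the Rayleigh quotient, and that quotient is itself an upper row

HONEST FRAMING (verbatim): certified bounds for a stated model Hamiltonian in a stated basis; not a
claim about the real molecule beyond that model.

LADDER-CHEM I-TYPE slot 06 (cell chem-oracle, seat chem-type-06, 2026-08-26; zero compute; PROVED glue only,
0 sorry, no claim node; nothing here asserts a bound about any model). AUDIT RESULT: the exact-rational CI
certificate record of the cell EXISTS — `CIVec k n` of `Rows/CIUpperBound.lean` (basis labels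
`det : Fin n → Finset (Orb (Fin k))` = occupied spin orbitals in the Jordan–Wigner order `2p + σ` of FORMAT-qcu0 §1;
coefficients `coeff : Fin n → ℚ`), with the kernel-computable rationals `CIVec.energy F ψ = Σ_ij c_i c_j ⟨D_i|H_F|D_j⟩`
(Slater–Condon mirror `Model.slaterCondon`) and `CIVec.normSq ψ = Σ_ij c_i c_j [D_i = D_j]`, the bridges
`CIVec.star_vec_dotProduct_hamiltonian_mulVec : ⟨ψ, H_F ψ⟩ = energy`, `CIVec.star_vec_dotProduct_vec : ⟨ψ, ψ⟩ = normSq`,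
and the entry points `CIVec.upperCertificate` / `CIVec.upperRow` (`energy ≤ hi · normSq ⇒ UpperRow F a b hi`,
Rayleigh–Ritz in the sector via `Rows/SectorRows.lean` `upperRow_of_certificate` ←
`Literature/…/SecondQuantizedHamiltonian.lean` `sectorGroundEnergy_le_of_rayleigh`). This file records the one
sentence the index row of slot 06 needs as DECLARATIONS rather than prose:

* `CIVec.rayleighQuotient F ψ : ℚ := energy F ψ / normSq ψ` — THE EVALUATION of the record, Helgaker–Jørgensen–Olsen
  (2000) §4.2.3 eqs. (4.2.10)–(4.2.12), p. 113: "`E(C) = ⟨C|Ĥ|C⟩ / ⟨C|C⟩`" for the linear expansion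
  "`|C⟩ = Σ_{i=1}^m C_i |i⟩`" in Slater determinants (junk value `x / 0 = 0` when `normSq = 0`, i.e. `ψ.vec = 0`;
  every use below carries `0 < normSq`);
* `CIVec.cast_rayleighQuotient` — it IS the Rayleigh quotient of the Fock vector `ψ.vec = Σ_i c_i |D_i⟩`:
  `(rayleighQuotient : ℝ) = Re ⟨ψ, H_F ψ⟩ / Re ⟨ψ, ψ⟩` (the two bridges);
* `CIVec.upperCertificate_rayleighQuotient` / `CIVec.upperRow_rayleighQuotient` — for sector-pure determinants and
  `0 < normSq` the SHARPEST slot a CI certificate yields is its own quotient: `UpperRow F a b (rayleighQuotient F ψ)`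
  (symmetric model), hence `Model.energy F a b ≤ rayleighQuotient` (`CIVec.energy_le_rayleighQuotient`) and
  `UpperRow F a b hi` for every `hi ≥ rayleighQuotient` (`CIVec.upperRow_of_rayleighQuotient_le`; the readers table
  `hi` as an outward-rounded dyadic/decimal above the exact quotient — `CIVec.rayleighQuotient_le_iff` is the
  equivalence with the `energy ≤ hi · normSq` form the kernel decides).

Sources (pages opened): Helgaker–Jørgensen–Olsen, *Molecular Electronic-Structure Theory* (2000), §4.2.1 (4.2.2)
p. 111, §4.2.3 (4.2.10)–(4.2.12) p. 113, §4.2.5 p. 118 ("`E_C` will always be an upper bound to the exact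
ground-state energy `E₁`"); Horn–Johnson, *Matrix Analysis*, Thm 4.2.2 (Rayleigh), p. 234. Companion (generic
and sector quotient / least-eigenvalue forms): `Literature/MathematicalPhysics/QuantumChemistry/SectorRayleighRitz.lean`.
NOT here: new certificate classes, faster kernel feeds (`Rows/CIEnergySymmetric.lean`, `Rows/CIFastRows.lean`),
MPS witnesses (`Rows/MPSUpperBound.lean`).
-/

namespace Summit.Ventures.CertifiedQuantumChemistry

open Matrix Finset
open Literature.MathematicalPhysics.QuantumLattice Literature.MathematicalPhysics.QuantumChemistry

namespace CIVec

variable {k n : ℕ}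

/-- **The evaluation of an exact-`ℚ` CI record**: the rational Rayleigh quotient
`E(C) = ⟨C|H_F|C⟩ / ⟨C|C⟩ = energy F ψ / normSq ψ` of the trial vector `ψ = Σ_i c_i |D_i⟩`
(Helgaker–Jørgensen–Olsen (2000) eqs. (4.2.10)–(4.2.12), p. 113). Junk value `0` when `normSq ψ = 0`
(`x / 0 = 0`); rows below assume `0 < normSq`. [cite: HelgakerJorgensenOlsen2000, eq. (4.2.12), p. 113] -/
def rayleighQuotient (F : Model k) (ψ : CIVec k n) : ℚ := ψ.energy F / ψ.normSq

/-- Unfolding: `rayleighQuotient F ψ = energy F ψ / normSq ψ`. -/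
theorem rayleighQuotient_def (F : Model k) (ψ : CIVec k n) : ψ.rayleighQuotient F = ψ.energy F / ψ.normSq :=
  rfl

/-- Clearing the denominator: `rayleighQuotient · normSq = energy` when `0 < normSq`. -/
theorem rayleighQuotient_mul_normSq (F : Model k) (ψ : CIVec k n) (hpos : 0 < ψ.normSq) :
    ψ.rayleighQuotient F * ψ.normSq = ψ.energy F :=
  div_mul_cancel₀ _ hpos.ne'

/-- The two shapes of a CI upper certificate agree: `rayleighQuotient ≤ hi ↔ energy ≤ hi · normSq` (`0 < normSq`);
the right-hand side is the decidable statement the kernel closes (`Rows/CIUpperBound.lean`). -/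
theorem rayleighQuotient_le_iff (F : Model k) (ψ : CIVec k n) (hpos : 0 < ψ.normSq) (hi : ℚ) :
    ψ.rayleighQuotient F ≤ hi ↔ ψ.energy F ≤ hi * ψ.normSq :=
  div_le_iff₀ hpos

/-- **The record's evaluation IS the Rayleigh quotient of its Fock vector**:
`(rayleighQuotient F ψ : ℝ) = Re ⟨ψ.vec, H_F ψ.vec⟩ / Re ⟨ψ.vec, ψ.vec⟩` — the energy functional
`E[0̃] = ⟨0̃|Ĥ|0̃⟩/⟨0̃|0̃⟩` (Helgaker–Jørgensen–Olsen (2000) eq. (4.2.2), p. 111) at `0̃ = Σ_i c_i |D_i⟩`, by the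
bridges `star_vec_dotProduct_hamiltonian_mulVec` and `star_vec_dotProduct_vec` (both sides exact rationals; no
hypothesis — at `normSq = 0` both quotients are the junk value `0`).
[cite: HelgakerJorgensenOlsen2000, eq. (4.2.2), p. 111] -/
theorem cast_rayleighQuotient (F : Model k) (ψ : CIVec k n) :
    ((ψ.rayleighQuotient F : ℚ) : ℝ) =
      (star ψ.vec ⬝ᵥ F.hamiltonian *ᵥ ψ.vec).re / (star ψ.vec ⬝ᵥ ψ.vec).re := by
  rw [star_vec_dotProduct_hamiltonian_mulVec, star_vec_dotProduct_vec, Complex.ratCast_re, Complex.ratCast_re,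
    rayleighQuotient, Rat.cast_div]

/-- **The quotient itself is an upper certificate**: sector-pure determinants and `0 < normSq` give
`UpperCertificate F a b (rayleighQuotient F ψ)` — the sharpest slot this trial vector yields
(`CIVec.upperCertificate` at `hi = energy / normSq`). Helgaker–Jørgensen–Olsen (2000) §4.2.5, p. 118:
"`E_C` will always be an upper bound to the exact ground-state energy". -/
theorem upperCertificate_rayleighQuotient (F : Model k) (ψ : CIVec k n) {a b : ℕ} (hsec : ψ.InSector a b)
    (hpos : 0 < ψ.normSq) : UpperCertificate F a b (ψ.rayleighQuotient F) :=
  upperCertificate F ψ hsec hpos (le_of_eq (rayleighQuotient_mul_normSq F ψ hpos).symm)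

/-- **The quotient is an upper ROW** for a symmetric model: `UpperRow F a b (rayleighQuotient F ψ)`, i.e.
`a ≤ k ∧ b ≤ k ∧ E₀(H_F; a, b) ≤ ⟨ψ, H_F ψ⟩/⟨ψ, ψ⟩` — Rayleigh–Ritz in the `(a, b)` sector
(`upperRow_of_certificate` ← `sectorGroundEnergy_le_of_rayleigh`; Horn–Johnson Thm 4.2.2 (a), p. 234;
Helgaker–Jørgensen–Olsen (2000) eq. (4.2.12), p. 113, and §4.2.5, p. 118). -/
theorem upperRow_rayleighQuotient {F : Model k} (hF : F.IsSymmetric) (ψ : CIVec k n) {a b : ℕ}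
    (hsec : ψ.InSector a b) (hpos : 0 < ψ.normSq) : UpperRow F a b (ψ.rayleighQuotient F) :=
  upperRow_of_certificate hF (upperCertificate_rayleighQuotient F ψ hsec hpos)

/-- The certified quantity under the quotient: `Model.energy F a b ≤ (rayleighQuotient F ψ : ℝ)` for a symmetric
model, sector-pure determinants and `0 < normSq` (Helgaker–Jørgensen–Olsen (2000) §4.2.5, p. 118). -/
theorem energy_le_rayleighQuotient {F : Model k} (hF : F.IsSymmetric) (ψ : CIVec k n) {a b : ℕ}
    (hsec : ψ.InSector a b) (hpos : 0 < ψ.normSq) : F.energy a b ≤ ((ψ.rayleighQuotient F : ℚ) : ℝ) :=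
  (upperRow_rayleighQuotient hF ψ hsec hpos).le

/-- Every slot above the quotient is an upper row: `rayleighQuotient F ψ ≤ hi ⇒ UpperRow F a b hi` (the form a
reader tables: `hi` an outward-rounded dyadic/decimal above the exact quotient; `UpperRow.mono`). -/
theorem upperRow_of_rayleighQuotient_le {F : Model k} (hF : F.IsSymmetric) (ψ : CIVec k n) {a b : ℕ}
    (hsec : ψ.InSector a b) (hpos : 0 < ψ.normSq) {hi : ℚ} (hle : ψ.rayleighQuotient F ≤ hi) :
    UpperRow F a b hi :=
  (upperRow_rayleighQuotient hF ψ hsec hpos).mono hle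

end CIVec

end Summit.Ventures.CertifiedQuantumChemistry
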